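import Literature.NumberTheory.LFunctions.WeilZeroSum
import HarnessLib

/-!
# Absolute summability of the zero heat trace

Stub `stub_heatSummable` of the line "Sketch (heat cone)" for the crux
`Summit.RiemannHypothesis.RiemannHypothesis.Theses.RuelleBand.ExactFirstBand`: for `t > 0` the
series `Σ_ρ m(ρ) e^{-t Re(ρ(1-ρ))}` over the non-trivial zeros of `ζ` (multiplicity
`m(ρ) = riemannZetaZeroOrder ρ ≥ 0`) converges.  With `ρ = β + iγ`, `0 < β < 1`, one has
`Re(ρ(1-ρ)) = β(1-β) + γ² ≥ γ²`, and `e^{-tγ²} ≤ (2 + 4/t²)/(1+γ²)²`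
(`e^{tx} ≥ 1 + tx + t²x²/2`, `(1+x)² ≤ 2(1+x²)`), so the tree's summability test
`Literature.NumberTheory.LFunctions.summable_norm_zeroSide_of_le` (i.e. `weilZeroSummable`,
`Σ m(ρ)/(1+γ²)² < ∞`, Jensen) applies with `a ρ = e^{-tρ(1-ρ)}`.
-/

set_option linter.dupNamespace false

noncomputable section

open Complex

namespace Summit.RiemannHypothesis.RiemannHypothesis.Theorems.RuelleBandExactFirstBand

open Literature.NumberTheory.LFunctions

/-- Elementary Gaussian-vs-rational comparison: for `t > 0` and `x ≥ 0`,
`e^{-tx} ≤ (2 + 4/t²)/(1+x)²` (from `1 + tx + (tx)²/2 ≤ e^{tx}` and `(1+x)² ≤ 2 + 2x²`). -/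
theorem stub_heatSummable_exp_le {t x : ℝ} (ht : 0 < t) (hx : 0 ≤ x) :
    Real.exp (-(t * x)) ≤ (2 + 4 / t ^ 2) / (1 + x) ^ 2 := by
  have hE : 1 + t * x + (t * x) ^ 2 / 2 ≤ Real.exp (t * x) :=
    Real.quadratic_le_exp_of_nonneg (mul_nonneg ht.le hx)
  have hc : 4 / t ^ 2 * t ^ 2 = 4 := div_mul_cancel₀ _ (by positivity)
  have hc0 : 0 ≤ 4 / t ^ 2 := by positivity
  have hpos : 0 < Real.exp (t * x) := Real.exp_pos _
  rw [le_div_iff₀ (by positivity), Real.exp_neg, inv_mul_le_iff₀ hpos]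
  calc (1 + x) ^ 2 ≤ 2 + 2 * x ^ 2 := by nlinarith [sq_nonneg (1 - x)]
    _ = 2 + 4 / t ^ 2 * t ^ 2 * x ^ 2 / 2 := by rw [hc]; ring
    _ ≤ (1 + t * x + (t * x) ^ 2 / 2) * (2 + 4 / t ^ 2) := by
        nlinarith [mul_nonneg ht.le hx, mul_nonneg hc0 (mul_nonneg ht.le hx)]
    _ ≤ Real.exp (t * x) * (2 + 4 / t ^ 2) := mul_le_mul_of_nonneg_right hE (by positivity)

/-- On the open critical strip the heat exponent dominates the Gaussian one:
`Re(ρ(1-ρ)) = Re ρ (1 - Re ρ) + (Im ρ)² ≥ (Im ρ)²` for `0 < Re ρ < 1`. -/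
theorem stub_heatSummable_sq_im_le_re {ρ : ℂ} (h0 : 0 < ρ.re) (h1 : ρ.re < 1) :
    ρ.im ^ 2 ≤ (ρ * (1 - ρ)).re := by
  have hre : (ρ * (1 - ρ)).re = ρ.re * (1 - ρ.re) + ρ.im ^ 2 := by
    simp only [mul_re, sub_re, one_re, sub_im, one_im]
    ring
  rw [hre]
  nlinarith [mul_pos h0 (sub_pos.2 h1)]

/-- For `t > 0` and a non-trivial zero `ρ`, `‖e^{-tρ(1-ρ)}‖ ≤ (2 + 4/t²)/(1 + (Im ρ)²)²`. -/
theorem stub_heatSummable_norm_exp_le {t : ℝ} (ht : 0 < t) {ρ : ℂ}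
    (hρ : ρ ∈ ZetaZeros.riemannZetaNontrivialZeros) :
    ‖cexp (-((t : ℂ) * (ρ * (1 - ρ))))‖ ≤ (2 + 4 / t ^ 2) / (1 + ρ.im ^ 2) ^ 2 := by
  have h0 := ZetaZeros.riemannZetaNontrivialZeros.re_pos hρ
  have h1 := ZetaZeros.riemannZetaNontrivialZeros.re_lt_one hρ
  rw [Complex.norm_exp, neg_re, re_ofReal_mul]
  calc Real.exp (-(t * (ρ * (1 - ρ)).re))
      ≤ Real.exp (-(t * ρ.im ^ 2)) := by
        rw [Real.exp_le_exp]
        have h := stub_heatSummable_sq_im_le_re h0 h1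
        nlinarith [mul_le_mul_of_nonneg_left h ht.le]
    _ ≤ (2 + 4 / t ^ 2) / (1 + ρ.im ^ 2) ^ 2 := stub_heatSummable_exp_le ht (sq_nonneg _)

/-- **Absolute summability of the zero heat trace.** For `t > 0`,
`Σ_ρ m(ρ) e^{-t Re(ρ(1-ρ))} < ∞` over the non-trivial zeros of `ζ`: `Re(ρ(1-ρ)) = β(1-β) + γ² ≥ γ²`
and `e^{-tγ²} ≤ (2 + 4/t²)/(1+γ²)²`, so the tree's test
`Literature.NumberTheory.LFunctions.summable_norm_zeroSide_of_le` (from `weilZeroSummable`,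
`Σ m(ρ)/(1+γ²)² < ∞`) applies to `a ρ = e^{-tρ(1-ρ)}`, whose weighted norm
`‖m(ρ) e^{-tρ(1-ρ)}‖ = m(ρ) e^{-t Re(ρ(1-ρ))}` is the summand. -/
theorem stub_heatSummable :
    ∀ t : ℝ, 0 < t → Summable (fun ρ : ZetaZeros.riemannZetaNontrivialZeros =>
      (riemannZetaZeroOrder (ρ : ℂ) : ℝ) * Real.exp (-(t * ((ρ : ℂ) * (1 - (ρ : ℂ))).re))) := by
  intro t ht
  have h := summable_norm_zeroSide_of_le (a := fun ρ : ℂ => cexp (-((t : ℂ) * (ρ * (1 - ρ)))))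
    (K := 2 + 4 / t ^ 2) (fun ρ hρ => stub_heatSummable_norm_exp_le ht hρ)
  refine h.congr fun ρ => ?_
  have hm : (0 : ℝ) ≤ riemannZetaZeroOrder (ρ : ℂ) := by
    exact_mod_cast riemannZetaZeroOrder_nonneg (ZetaZeros.riemannZetaNontrivialZeros.ne_one ρ.2)
  rw [norm_mul, Complex.norm_intCast, abs_of_nonneg hm, Complex.norm_exp, neg_re, re_ofReal_mul]

end Summit.RiemannHypothesis.RiemannHypothesis.Theorems.RuelleBandExactFirstBand

end
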